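import Literature.Computability.AlgebraicComplexity.SLOrbitQuotientSetup
import Literature.Computability.AlgebraicComplexity.SLOrbitOpenInClosure
import HarnessLib

/-!
# The orbit map of a closed `SL`-orbit is a quotient — the points of `ℂ[SL·w]` are the orbit

Topic `Literature/Computability/AlgebraicComplexity`, cell `val-lit`, PROGRAMME #7 (discharge of
`Grosshans1997_thm_1_11_slOrbit_forms`; architect `val-lit-t02 g7`, note
`HOME/bip/NOTE-t02g7-E2-Grosshans-orbit-quotient-sizing.md`, currency file `SLOrbitQuotientSetup.lean`).
Step S3 of the note, «MaxSpec `A` = the closed orbit: every `ℂ`-algebra map `A → ℂ` is evaluation at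
some `g·w` (`A ≅ ℂ[V]/I(SL·w)`, `I` radical, `Z(I) = SL·w` because the orbit is Zariski closed =
`IsPolystable`)», for `A = orbitPullbacks w m = ℂ[SL·w]` (the pull-backs `g ↦ F(g·w)` of polynomial
functions on `Sym^m`), in three forms:

* `ker_orbitPullback_eq_vanishingIdeal` — the kernel of `π^* : ℂ[Sym^m] → (SL → ℂ)` is the ideal of
  the orbit `I(formCoeff m '' SL·w)` (any form `w`);
* `exists_eq_charAt_orbitPullbacks` — for a POLYSTABLE form `w` of degree `m`, every `ℂ`-algebra
  homomorphism `ℂ[SL·w] → ℂ` is the character `charAt _ g` of a point `g ∈ SL_σ(ℂ)` (the point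
  `x_d = φ(g ↦ coeff_d(g·w))` of `Sym^m` is a zero of `I(SL·w)`, hence — the orbit being Zariski closed
  in `Sym^m`, `IsPolystable.zeroLocus_vanishingIdeal_subset` of `SLOrbitOpenInClosure.lean` — a point
  `g·w` of the orbit);
* `exists_eq_ker_charAt_orbitPullbacks_of_isMaximal` — every maximal ideal of `ℂ[SL·w]` is the kernel of such a
  character (Nullstellensatz `MvPolynomial.isMaximal_iff_eq_vanishingIdeal_singleton` pulled back along
  the surjection `ℂ[Sym^m] → ℂ[SL·w]`).

Theorem-only (kernel lane), no new definition or fact. Honest framing: textbook algebraic geometry of a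
closed orbit (Grosshans 1997 §1 / Springer 1998 1.3.1, points = maximal ideals); bookkeeping for the GCT
row GRO97-A; nothing here bears on VP ≠ VNP, which is NOT proved.

Provenance: text of val-lit-t14 g6 (p505286); restored verbatim by val-lit-t02 g7 after its
whole-file proposal p505501 at the same target had replaced it, with t02's
`exists_ker_charAt_orbitPullbacks_eq` kept as an alias (used by the assembly file
`SLOrbitQuotientHolds.lean`).

## References

* [Grosshans1997] F. D. Grosshans, *Algebraic Homogeneous Spaces and Invariant Theory*, LNM 1673
  (1997), Thm. 1.11 and §1.
* [SpringerLAG1998] T. A. Springer, *Linear Algebraic Groups*, 2nd ed. (1998), 1.3.1 (points of an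
  affine variety = `k`-algebra homomorphisms `k[X] → k` = maximal ideals), Lemma 2.3.3.
* [BurgisserIkenmeyer2017] P. Bürgisser, C. Ikenmeyer, J. Algebra 477 (2017), Def. 2.7 (polystable =
  closed `SL`-orbit).
-/

noncomputable section

open MvPolynomial

namespace Literature.Computability.AlgebraicComplexity

namespace SLOrbitQuotient

variable {σ : Type} [Fintype σ] [DecidableEq σ]

/-! ### The kernel of the pull-back -/

/-- The coordinate pull-backs lie in `ℂ[SL·w]`. [cite: Grosshans1997, Thm. 1.11] -/
theorem orbitFn_mem_orbitPullbacks (w : MvPolynomial σ ℂ) (m : ℕ) (d : DegIdx σ m) :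
    orbitFn w m d ∈ orbitPullbacks w m := by
  rw [orbitPullbacks_eq_adjoin]
  exact Algebra.subset_adjoin ⟨d, rfl⟩

/-- **The kernel of `π^* : ℂ[Sym^m] → (SL → ℂ)` is the ideal of the orbit** `I(formCoeff m '' SL·w)`
(a polynomial function pulls back to `0` iff it vanishes at every `g·w`). [cite: Grosshans1997, Thm. 1.11 (k[G·x] = k[V]/I(G·x))] -/
theorem ker_orbitPullback_eq_vanishingIdeal (w : MvPolynomial σ ℂ) (m : ℕ) :
    RingHom.ker (orbitPullback w m) =
      MvPolynomial.vanishingIdeal ℂ (formCoeff m '' slOrbit σ ℂ w) := by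
  ext F
  rw [RingHom.mem_ker, MvPolynomial.mem_vanishingIdeal_iff]
  constructor
  · intro hF
    rintro _ ⟨_, ⟨g, rfl⟩, rfl⟩
    rw [← orbitPullback_apply, hF]
    rfl
  · intro hF
    funext g
    rw [orbitPullback_apply]
    exact hF _ ⟨_, ⟨g, rfl⟩, rfl⟩

/-- A `ℂ`-algebra homomorphism `φ : ℂ[SL·w] → ℂ` is, on pull-backs, evaluation of polynomial functions at
the point `x_d = φ(g ↦ coeff_d(g·w))` of `Sym^m`. [cite: SpringerLAG1998, 1.3.1 (points as algebra homomorphisms)] -/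
theorem apply_orbitPullback_eq_aeval (w : MvPolynomial σ ℂ) (m : ℕ)
    (φ : ↥(orbitPullbacks w m) →ₐ[ℂ] ℂ) (F : MvPolynomial (DegIdx σ m) ℂ) :
    φ ⟨orbitPullback w m F, (AlgHom.mem_range _).mpr ⟨F, rfl⟩⟩ =
      aeval (fun d : DegIdx σ m => φ ⟨orbitFn w m d, orbitFn_mem_orbitPullbacks w m d⟩) F := by
  -- `φ ∘ π^*` is an algebra map out of a polynomial ring: it is `aeval` at its values on the `X_d`
  set ψ : MvPolynomial (DegIdx σ m) ℂ →ₐ[ℂ] ℂ := φ.comp (orbitPullback w m).rangeRestrict with hψ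
  have hψF : ψ F = φ ⟨orbitPullback w m F, (AlgHom.mem_range _).mpr ⟨F, rfl⟩⟩ := rfl
  have hψX : (fun d : DegIdx σ m => ψ (X d)) =
      fun d => φ ⟨orbitFn w m d, orbitFn_mem_orbitPullbacks w m d⟩ := by
    funext d
    rw [hψ, AlgHom.comp_apply]
    congr 1
    apply Subtype.ext
    change orbitPullback w m (X d) = orbitFn w m d
    unfold orbitPullback
    rw [aeval_X]
  have key : ψ = aeval (fun d : DegIdx σ m => ψ (X d)) := MvPolynomial.aeval_unique ψ
  rw [← hψF, ← hψX]
  exact congrArg (fun χ : MvPolynomial (DegIdx σ m) ℂ →ₐ[ℂ] ℂ => χ F) key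

/-- The point `x_d = φ(g ↦ coeff_d(g·w))` of a character `φ` of `ℂ[SL·w]` is a zero of the ideal of the
orbit. [cite: SpringerLAG1998, 1.3.1 (points as algebra homomorphisms)] -/
theorem point_mem_zeroLocus (w : MvPolynomial σ ℂ) (m : ℕ) (φ : ↥(orbitPullbacks w m) →ₐ[ℂ] ℂ) :
    (fun d : DegIdx σ m => φ ⟨orbitFn w m d, orbitFn_mem_orbitPullbacks w m d⟩) ∈
      MvPolynomial.zeroLocus ℂ (MvPolynomial.vanishingIdeal ℂ (formCoeff m '' slOrbit σ ℂ w)) := by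
  rw [MvPolynomial.mem_zeroLocus_iff]
  intro F hF
  rw [← ker_orbitPullback_eq_vanishingIdeal, RingHom.mem_ker] at hF
  rw [← apply_orbitPullback_eq_aeval]
  have h0 : (⟨orbitPullback w m F, (AlgHom.mem_range _).mpr ⟨F, rfl⟩⟩ : ↥(orbitPullbacks w m)) = 0 :=
    Subtype.ext hF
  rw [h0, map_zero]

/-! ### Points of `ℂ[SL·w]` for a polystable `w` -/

/-- **MaxSpec `ℂ[SL·w]` = the closed orbit, character form** (S3 of the programme): for a POLYSTABLE
form `w` of degree `m`, every `ℂ`-algebra homomorphism `ℂ[SL·w] → ℂ` is the character of a point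
`g ∈ SL_σ(ℂ)`, i.e. evaluation at `g` (its point in `Sym^m` is a zero of `I(SL·w)`, and the orbit is
Zariski closed in `Sym^m`). [cite: Grosshans1997, Thm. 1.11 (the orbit map is onto the closed orbit)]
[cite: BurgisserIkenmeyer2017, Def. 2.7] -/
theorem exists_eq_charAt_orbitPullbacks {w : MvPolynomial σ ℂ} {m : ℕ} (hw : w.IsHomogeneous m)
    (hps : IsPolystable w) (φ : ↥(orbitPullbacks w m) →ₐ[ℂ] ℂ) :
    ∃ g : Matrix.SpecialLinearGroup σ ℂ, φ = charAt (orbitPullbacks w m) g := by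
  obtain ⟨_, ⟨g, rfl⟩, hg⟩ := IsPolystable.zeroLocus_vanishingIdeal_subset hps hw (point_mem_zeroLocus w m φ)
  refine ⟨g, ?_⟩
  apply AlgHom.ext
  rintro ⟨p, hp⟩
  obtain ⟨F, rfl⟩ := (AlgHom.mem_range _).mp hp
  rw [charAt_apply, apply_orbitPullback_eq_aeval, ← hg]
  exact (orbitPullback_apply w m F g).symm

/-- Point form: the values of a character of `ℂ[SL·w]` on the coordinate pull-backs are the
coefficients of a point `g·w` of the orbit (`w` polystable of degree `m`).
[cite: Grosshans1997, Thm. 1.11 (the orbit map is onto the closed orbit)] -/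
theorem exists_forall_apply_orbitFn_eq_of_isPolystable {w : MvPolynomial σ ℂ} {m : ℕ}
    (hw : w.IsHomogeneous m) (hps : IsPolystable w) (φ : ↥(orbitPullbacks w m) →ₐ[ℂ] ℂ) :
    ∃ g : Matrix.SpecialLinearGroup σ ℂ, ∀ d : DegIdx σ m,
      φ ⟨orbitFn w m d, orbitFn_mem_orbitPullbacks w m d⟩ =
        coeff d.1 (linSubst σ ℂ (g : Matrix σ σ ℂ) w) := by
  obtain ⟨g, hg⟩ := exists_eq_charAt_orbitPullbacks hw hps φ
  refine ⟨g, fun d => ?_⟩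
  rw [hg, charAt_apply]
  rfl

/-- **MaxSpec `ℂ[SL·w]` = the closed orbit, ideal form** (S3): for a polystable form `w` of degree
`m`, every maximal ideal of `ℂ[SL·w]` is the kernel of the character of a point `g ∈ SL_σ(ℂ)`
(Nullstellensatz on `ℂ[Sym^m]` pulled back along the surjection `π^* : ℂ[Sym^m] → ℂ[SL·w]`).
[cite: Grosshans1997, Thm. 1.11 (the orbit map is onto the closed orbit)]
[cite: SpringerLAG1998, 1.3.1 (maximal ideals = points)] -/
theorem exists_eq_ker_charAt_orbitPullbacks_of_isMaximal {w : MvPolynomial σ ℂ} {m : ℕ}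
    (hw : w.IsHomogeneous m) (hps : IsPolystable w) {n : Ideal ↥(orbitPullbacks w m)} (hn : n.IsMaximal) :
    ∃ g : Matrix.SpecialLinearGroup σ ℂ, n = RingHom.ker (charAt (orbitPullbacks w m) g) := by
  -- pull `n` back to a maximal ideal of the polynomial ring: a point `x` of `Sym^m`
  set ρ : MvPolynomial (DegIdx σ m) ℂ →ₐ[ℂ] ↥(orbitPullbacks w m) :=
    (orbitPullback w m).rangeRestrict with hρ
  have hρsurj : Function.Surjective ρ := (orbitPullback w m).rangeRestrict_surjective
  haveI : (n.comap ρ).IsMaximal := Ideal.comap_isMaximal_of_surjective ρ hρsurj (H := hn)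
  obtain ⟨x, hx⟩ := (MvPolynomial.isMaximal_iff_eq_vanishingIdeal_singleton (I := n.comap ρ)).mp
    inferInstance
  -- `x` is a zero of `I(SL·w)` (the kernel of `ρ` lies in `n.comap ρ`)
  have hxZ : x ∈ MvPolynomial.zeroLocus ℂ
      (MvPolynomial.vanishingIdeal ℂ (formCoeff m '' slOrbit σ ℂ w)) := by
    rw [MvPolynomial.mem_zeroLocus_iff]
    intro F hF
    rw [← ker_orbitPullback_eq_vanishingIdeal, RingHom.mem_ker] at hF
    have hFn : F ∈ n.comap ρ := by
      rw [Ideal.mem_comap]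
      have : ρ F = 0 := Subtype.ext hF
      rw [this]
      exact n.zero_mem
    rw [hx] at hFn
    exact (MvPolynomial.mem_vanishingIdeal_iff.mp hFn) x rfl
  -- hence a point of the orbit
  obtain ⟨_, ⟨g, rfl⟩, hg⟩ := IsPolystable.zeroLocus_vanishingIdeal_subset hps hw hxZ
  refine ⟨g, hn.eq_of_le (RingHom.ker_ne_top _) fun a ha => ?_⟩
  -- `n ≤ ker (charAt g)`
  obtain ⟨F, rfl⟩ := hρsurj a
  have hFx : aeval x F = 0 := by
    have hFn : F ∈ n.comap ρ := Ideal.mem_comap.mpr ha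
    rw [hx] at hFn
    exact (MvPolynomial.mem_vanishingIdeal_iff.mp hFn) x rfl
  rw [RingHom.mem_ker, charAt_apply]
  change orbitPullback w m F g = 0
  rw [orbitPullback_apply, hg, hFx]

/-- Conversely every `g ∈ SL_σ(ℂ)` gives a point: the characters `charAt (orbitPullbacks w m) g` exhaust
the `ℂ`-points of `ℂ[SL·w]`, and two of them coincide iff `g·w = g'·w`
(`linSubst_eq_of_ker_charAt_orbitPullbacks_eq`): **MaxSpec `ℂ[SL·w]` is in bijection with the orbit
`SL·w`** for `w` polystable. [cite: Grosshans1997, Thm. 1.11 (the orbit map is onto the closed orbit)] -/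
theorem ker_charAt_eq_iff_linSubst_eq {w : MvPolynomial σ ℂ} {m : ℕ} (hw : w.IsHomogeneous m)
    (g g' : Matrix.SpecialLinearGroup σ ℂ) :
    RingHom.ker (charAt (orbitPullbacks w m) g) = RingHom.ker (charAt (orbitPullbacks w m) g') ↔
      linSubst σ ℂ (g : Matrix σ σ ℂ) w = linSubst σ ℂ (g' : Matrix σ σ ℂ) w := by
  refine ⟨linSubst_eq_of_ker_charAt_orbitPullbacks_eq hw, fun h => ?_⟩
  ext ⟨p, hp⟩
  obtain ⟨F, rfl⟩ := (AlgHom.mem_range _).mp hp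
  simp only [RingHom.mem_ker, charAt_apply]
  change orbitPullback w m F g = 0 ↔ orbitPullback w m F g' = 0
  rw [orbitPullback_apply, orbitPullback_apply, h]

/-- **MaxSpec `ℂ[SL·w]` = the closed orbit, ideal form** — the same statement with the maximal ideal
explicit (the name used by the assembly file `SLOrbitQuotientHolds.lean`).
[cite: Grosshans1997, Thm. 1.11 (the orbit map is onto the closed orbit)] -/
theorem exists_ker_charAt_orbitPullbacks_eq {w : MvPolynomial σ ℂ} {m : ℕ} (hw : w.IsHomogeneous m)
    (hst : IsPolystable w) (𝔪 : Ideal (orbitPullbacks w m)) (h𝔪 : 𝔪.IsMaximal) :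
    ∃ g : Matrix.SpecialLinearGroup σ ℂ, 𝔪 = RingHom.ker (charAt (orbitPullbacks w m) g) :=
  exists_eq_ker_charAt_orbitPullbacks_of_isMaximal hw hst h𝔪

end SLOrbitQuotient

end Literature.Computability.AlgebraicComplexity

end
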